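import Mathlib

/-!
# Crux `LevyNegativeMoment` (stmt-AtomisticToContinuum-9115), line `registered`, stub `stub_rieszSum` —
# part B: the profile `g_ρ(x) = (x² + ρ²)^{-1/2}`

Helper file (lead prover of the line) for the L-free grid Riesz sum bound (stub `stub_rieszSum`).  After the
coordinate split `q = (t, p)` the amplitude seen by the character sum in `t` is `g_ρ(t̄)` with
`g_ρ(x) = 1/√(x² + ρ²)`, `ρ² = ‖p̄‖²`.  This file collects the one-variable analysis of `g_ρ` that the cyclic Abel
bounds of part A consume:

* elementary size facts (`0 < g ≤ 1/ρ`, `|x| g ≤ 1`, antitone on `[0,∞)`, the algebraic two-point bound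
  `g x - g y ≤ (y² - x²) g(x)³/2` used for the zone-boundary kink);
* the derivative chain `g' = -x g³`, `g'' = -g³ + 3x²g⁵`, `g''' = 9x g⁵ - 15 x³ g⁷`, `|g'''| ≤ 24 g⁴`;
* a mean-value bound for third forward differences (`|Δ³f(u)| ≤ sup |f'''|` on `[u, u+3]`), hence
  `|Δ³ g_ρ(x)| ≤ 24/((x ∨ 0)² + ρ²)²` for `x ≥ -3`, and the summed form `Σ_{u<K} |Δ³g_ρ(u - σ)| ≤ 144/ρ³`
  (`σ ≤ 2`, `ρ ≥ 1`), via `Σ_{v<K} 1/(v² + ρ²) ≤ 4/ρ`.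

All statements are about an arbitrary `g` satisfying `g y = (√(y²+ρ²))⁻¹` (no new definitions).
-/

namespace Summit.AtomisticToContinuum.BoseEinsteinCondensation.Cruxes.LevyNegativeMoment.Birth.Riesz

open scoped BigOperators
open Finset

/-! ## A mean-value bound for third forward differences -/

/-- One forward difference of a differentiable function is a derivative value (mean value theorem on
`[a, a+1]`). [folklore] -/
theorem exists_forwardDiff_eq_deriv {F F' : ℝ → ℝ} (hF : ∀ x, HasDerivAt F (F' x) x) (a : ℝ) :
    ∃ c ∈ Set.Ioo a (a + 1), F (a + 1) - F a = F' c := by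
  have hc : ContinuousOn F (Set.Icc a (a + 1)) := fun x _ => (hF x).continuousAt.continuousWithinAt
  obtain ⟨c, hc, h⟩ := exists_hasDerivAt_eq_slope F F' (by linarith : a < a + 1) hc (fun x _ => hF x)
  refine ⟨c, hc, ?_⟩
  rw [h]
  simp

/-- The forward difference of `F` is differentiable with derivative the forward difference of `F'`.
[folklore] -/
theorem hasDerivAt_forwardDiff {F F' : ℝ → ℝ} (hF : ∀ x, HasDerivAt F (F' x) x) (x : ℝ) :
    HasDerivAt (fun y => F (y + 1) - F y) (F' (x + 1) - F' x) x :=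
  ((hF (x + 1)).comp_add_const x 1).sub (hF x)

/-- **Third differences are bounded by third derivatives**: if `f` has derivatives `f₁, f₂, f₃` of orders
one to three everywhere and `|f₃| ≤ M` on `[u, u+3]`, then `|f(u+3) - 3f(u+2) + 3f(u+1) - f(u)| ≤ M`
(three applications of the mean value theorem). [folklore] -/
theorem abs_third_diff_le {f f₁ f₂ f₃ : ℝ → ℝ} (h₁ : ∀ x, HasDerivAt f (f₁ x) x)
    (h₂ : ∀ x, HasDerivAt f₁ (f₂ x) x) (h₃ : ∀ x, HasDerivAt f₂ (f₃ x) x) {u M : ℝ}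
    (hM : ∀ x ∈ Set.Icc u (u + 3), |f₃ x| ≤ M) :
    |f (u + 3) - 3 * f (u + 2) + 3 * f (u + 1) - f u| ≤ M := by
  -- first differences and their derivatives
  set D1 : ℝ → ℝ := fun y => f (y + 1) - f y with hD1
  set D1' : ℝ → ℝ := fun y => f₁ (y + 1) - f₁ y with hD1'
  set D1'' : ℝ → ℝ := fun y => f₂ (y + 1) - f₂ y with hD1''
  have hD1d : ∀ x, HasDerivAt D1 (D1' x) x := fun x => hasDerivAt_forwardDiff h₁ x
  have hD1'd : ∀ x, HasDerivAt D1' (D1'' x) x := fun x => hasDerivAt_forwardDiff h₂ x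
  set D2 : ℝ → ℝ := fun y => D1 (y + 1) - D1 y with hD2
  set D2' : ℝ → ℝ := fun y => D1' (y + 1) - D1' y with hD2'
  have hD2d : ∀ x, HasDerivAt D2 (D2' x) x := fun x => hasDerivAt_forwardDiff hD1d x
  have e : f (u + 3) - 3 * f (u + 2) + 3 * f (u + 1) - f u = D2 (u + 1) - D2 u := by
    simp only [hD2, hD1]
    ring_nf
  obtain ⟨c₁, hc₁, e₁⟩ := exists_forwardDiff_eq_deriv hD2d u
  -- D2' c₁ = D1'(c₁+1) - D1' c₁
  obtain ⟨c₂, hc₂, e₂⟩ := exists_forwardDiff_eq_deriv hD1'd c₁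
  -- D1'' c₂ = f₂ (c₂+1) - f₂ c₂
  obtain ⟨c₃, hc₃, e₃⟩ := exists_forwardDiff_eq_deriv h₃ c₂
  rw [e, e₁, show D2' c₁ = D1' (c₁ + 1) - D1' c₁ from rfl, e₂,
    show D1'' c₂ = f₂ (c₂ + 1) - f₂ c₂ from rfl, e₃]
  apply hM
  simp only [Set.mem_Ioo, Set.mem_Icc] at hc₁ hc₂ hc₃ ⊢
  constructor <;> linarith

/-! ## The profile `g_ρ` -/

section profile

variable {ρ : ℝ} {g : ℝ → ℝ}

/-- `g_ρ > 0` (for `ρ ≠ 0`). [folklore] -/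
theorem G_pos (hg : ∀ y, g y = (Real.sqrt (y ^ 2 + ρ ^ 2))⁻¹) (hρ : ρ ≠ 0) (x : ℝ) : 0 < g x := by
  rw [hg]
  have : 0 < x ^ 2 + ρ ^ 2 := by positivity
  positivity

/-- `g_ρ ≥ 0` (any `ρ`). [folklore] -/
theorem G_nonneg (hg : ∀ y, g y = (Real.sqrt (y ^ 2 + ρ ^ 2))⁻¹) (x : ℝ) : 0 ≤ g x := by
  rw [hg]; positivity

/-- `g_ρ(x)² = 1/(x² + ρ²)`. [folklore] -/
theorem G_sq (hg : ∀ y, g y = (Real.sqrt (y ^ 2 + ρ ^ 2))⁻¹) (x : ℝ) : g x ^ 2 = (x ^ 2 + ρ ^ 2)⁻¹ := by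
  rw [hg, inv_pow, Real.sq_sqrt (by positivity)]

/-- `g_ρ ≤ 1/ρ` for `ρ > 0`. [folklore] -/
theorem G_le_inv (hg : ∀ y, g y = (Real.sqrt (y ^ 2 + ρ ^ 2))⁻¹) (hρ : 0 < ρ) (x : ℝ) : g x ≤ ρ⁻¹ := by
  rw [hg]
  apply inv_anti₀ hρ
  calc ρ = Real.sqrt (ρ ^ 2) := (Real.sqrt_sq hρ.le).symm
    _ ≤ Real.sqrt (x ^ 2 + ρ ^ 2) := Real.sqrt_le_sqrt (by nlinarith)

/-- `|x|·g_ρ(x) ≤ 1`. [folklore] -/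
theorem abs_mul_G_le_one (hg : ∀ y, g y = (Real.sqrt (y ^ 2 + ρ ^ 2))⁻¹) (x : ℝ) : |x| * g x ≤ 1 := by
  rw [hg]
  rcases eq_or_lt_of_le (Real.sqrt_nonneg (x ^ 2 + ρ ^ 2)) with h | h
  · rw [← h]; simp
  · rw [← div_eq_mul_inv, div_le_one h]
    calc |x| = Real.sqrt (x ^ 2) := (Real.sqrt_sq_eq_abs x).symm
      _ ≤ Real.sqrt (x ^ 2 + ρ ^ 2) := Real.sqrt_le_sqrt (by nlinarith)

/-- `g_ρ` is antitone on `[0, ∞)`. [folklore] -/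
theorem G_antitoneOn (hg : ∀ y, g y = (Real.sqrt (y ^ 2 + ρ ^ 2))⁻¹) (hρ : ρ ≠ 0) :
    AntitoneOn g (Set.Ici 0) := by
  intro x hx y _ hxy
  rw [hg, hg]
  have hx0 : (0 : ℝ) ≤ x := hx
  have : 0 < x ^ 2 + ρ ^ 2 := by positivity
  apply inv_anti₀ (Real.sqrt_pos.mpr this)
  exact Real.sqrt_le_sqrt (by nlinarith)

/-- `g_ρ` is antitone on `[1, ∞)` for every `ρ` (also `ρ = 0`, where `g_0(x) = 1/|x|`). [folklore] -/
theorem G_antitoneOn_one (hg : ∀ y, g y = (Real.sqrt (y ^ 2 + ρ ^ 2))⁻¹) : AntitoneOn g (Set.Ici 1) := by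
  intro x hx y _ hxy
  rw [hg, hg]
  have hx1 : (1 : ℝ) ≤ x := hx
  have : 0 < x ^ 2 + ρ ^ 2 := by positivity
  apply inv_anti₀ (Real.sqrt_pos.mpr this)
  exact Real.sqrt_le_sqrt (by nlinarith)

/-- The algebraic two-point bound `g x - g y ≤ (y² - x²)·g(x)³/2` for `0 ≤ x ≤ y` (`ρ ≠ 0`):
`g x - g y = (Y - X)/(√X √Y (√X + √Y))` with `X = x²+ρ²`, `Y = y²+ρ²`. [folklore] -/
theorem G_sub_G_le (hg : ∀ y, g y = (Real.sqrt (y ^ 2 + ρ ^ 2))⁻¹) (hρ : ρ ≠ 0) {x y : ℝ}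
    (hx : 0 ≤ x) (hxy : x ≤ y) : g x - g y ≤ (y ^ 2 - x ^ 2) * g x ^ 3 / 2 := by
  rw [hg, hg]
  set X := x ^ 2 + ρ ^ 2 with hX
  set Y := y ^ 2 + ρ ^ 2 with hY
  have hXpos : 0 < X := by positivity
  have hYpos : 0 < Y := by positivity
  have hXY : X ≤ Y := by rw [hX, hY]; nlinarith
  set a := Real.sqrt X with ha
  set b := Real.sqrt Y with hb
  have ha0 : 0 < a := Real.sqrt_pos.mpr hXpos
  have hb0 : 0 < b := Real.sqrt_pos.mpr hYpos
  have hab : a ≤ b := Real.sqrt_le_sqrt hXY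
  have ha2 : a ^ 2 = X := Real.sq_sqrt hXpos.le
  have hb2 : b ^ 2 = Y := Real.sq_sqrt hYpos.le
  have hYX : y ^ 2 - x ^ 2 = b ^ 2 - a ^ 2 := by rw [ha2, hb2, hX, hY]; ring
  rw [hYX]
  rw [le_div_iff₀ (by norm_num : (0:ℝ) < 2), sub_mul]
  -- goal: a⁻¹ * 2 - b⁻¹ * 2 ≤ (b² - a²) a⁻¹³
  rw [show a⁻¹ * 2 - b⁻¹ * 2 = 2 * (b - a) / (a * b) by field_simp]
  rw [show (b ^ 2 - a ^ 2) * a⁻¹ ^ 3 = (b - a) * (b + a) / a ^ 3 by field_simp; ring]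
  rw [div_le_div_iff₀ (by positivity) (by positivity)]
  -- 2 (b-a) a³ ≤ (b-a)(b+a) a b
  have hba : 0 ≤ b - a := by linarith
  nlinarith [mul_nonneg hba (mul_nonneg ha0.le (mul_nonneg ha0.le (by nlinarith : 0 ≤ a * b + b * b - 2 * a * a)))]

/-- `g' = -x g³`. [folklore] -/
theorem hasDerivAt_G (hg : ∀ y, g y = (Real.sqrt (y ^ 2 + ρ ^ 2))⁻¹) (hρ : ρ ≠ 0) (x : ℝ) :
    HasDerivAt g (-x * g x ^ 3) x := by
  obtain rfl : g = fun y => (Real.sqrt (y ^ 2 + ρ ^ 2))⁻¹ := funext hg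
  have hpos : 0 < x ^ 2 + ρ ^ 2 := by positivity
  have h1 : HasDerivAt (fun y => y ^ 2 + ρ ^ 2) (2 * x) x := by
    simpa using (hasDerivAt_pow 2 x).add_const (ρ ^ 2)
  have hs : Real.sqrt (x ^ 2 + ρ ^ 2) ≠ 0 := (Real.sqrt_pos.mpr hpos).ne'
  have h2 : HasDerivAt (fun y => Real.sqrt (y ^ 2 + ρ ^ 2))
      (2 * x / (2 * Real.sqrt (x ^ 2 + ρ ^ 2))) x := h1.sqrt hpos.ne'
  have h3 := h2.inv hs
  refine h3.congr_deriv ?_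
  field_simp

/-- `g'' = -g³ + 3x² g⁵`. [folklore] -/
theorem hasDerivAt_G' (hg : ∀ y, g y = (Real.sqrt (y ^ 2 + ρ ^ 2))⁻¹) (hρ : ρ ≠ 0) (x : ℝ) :
    HasDerivAt (fun y => -y * g y ^ 3) (-(g x) ^ 3 + 3 * x ^ 2 * g x ^ 5) x := by
  have h := hasDerivAt_G hg hρ x
  have hp : HasDerivAt (fun y => g y ^ 3) (3 * g x ^ 2 * (-x * g x ^ 3)) x := by
    simpa using h.fun_pow 3
  have hid : HasDerivAt (fun y : ℝ => -y) (-1) x := (hasDerivAt_id' x).neg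
  exact (hid.fun_mul hp).congr_deriv (by ring)

/-- `g''' = 9x g⁵ - 15x³ g⁷`. [folklore] -/
theorem hasDerivAt_G'' (hg : ∀ y, g y = (Real.sqrt (y ^ 2 + ρ ^ 2))⁻¹) (hρ : ρ ≠ 0) (x : ℝ) :
    HasDerivAt (fun y => -(g y) ^ 3 + 3 * y ^ 2 * g y ^ 5)
      (9 * x * g x ^ 5 - 15 * x ^ 3 * g x ^ 7) x := by
  have h := hasDerivAt_G hg hρ x
  have hp3 : HasDerivAt (fun y => g y ^ 3) (3 * g x ^ 2 * (-x * g x ^ 3)) x := by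
    simpa using h.fun_pow 3
  have hp5 : HasDerivAt (fun y => g y ^ 5) (5 * g x ^ 4 * (-x * g x ^ 3)) x := by
    simpa using h.fun_pow 5
  have hsq : HasDerivAt (fun y : ℝ => 3 * y ^ 2) (3 * (2 * x)) x := by
    simpa using (hasDerivAt_pow 2 x).const_mul 3
  exact (hp3.fun_neg.fun_add (hsq.fun_mul hp5)).congr_deriv (by ring)

/-- `|g'''| ≤ 24 g⁴` (from `|x| g ≤ 1`). [folklore] -/
theorem abs_G3_le (hg : ∀ y, g y = (Real.sqrt (y ^ 2 + ρ ^ 2))⁻¹) (x : ℝ) :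
    |9 * x * g x ^ 5 - 15 * x ^ 3 * g x ^ 7| ≤ 24 * g x ^ 4 := by
  have h0 : 0 ≤ g x := G_nonneg hg x
  have h1 : |x| * g x ≤ 1 := abs_mul_G_le_one hg x
  have hxg : 0 ≤ |x| * g x := mul_nonneg (abs_nonneg x) h0
  calc |9 * x * g x ^ 5 - 15 * x ^ 3 * g x ^ 7|
      ≤ |9 * x * g x ^ 5| + |15 * x ^ 3 * g x ^ 7| := abs_sub _ _
    _ = 9 * (|x| * g x) * g x ^ 4 + 15 * (|x| * g x) ^ 3 * g x ^ 4 := by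
        rw [abs_mul, abs_mul, abs_mul, abs_mul, abs_pow, abs_pow, abs_pow,
          abs_of_nonneg h0, abs_of_nonneg (by norm_num : (0:ℝ) ≤ 9),
          abs_of_nonneg (by norm_num : (0:ℝ) ≤ 15)]
        ring
    _ ≤ 9 * 1 * g x ^ 4 + 15 * 1 ^ 3 * g x ^ 4 := by
        gcongr
    _ = 24 * g x ^ 4 := by ring

/-- Pointwise third-difference bound:
`|g(x+3) - 3g(x+2) + 3g(x+1) - g(x)| ≤ 24/((x ∨ 0)² + ρ²)²` (`ρ ≠ 0`). [folklore] -/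
theorem abs_third_diff_G_le (hg : ∀ y, g y = (Real.sqrt (y ^ 2 + ρ ^ 2))⁻¹) (hρ : ρ ≠ 0) (x : ℝ) :
    |g (x + 3) - 3 * g (x + 2) + 3 * g (x + 1) - g x| ≤ 24 / ((max x 0) ^ 2 + ρ ^ 2) ^ 2 := by
  refine abs_third_diff_le (hasDerivAt_G hg hρ) (hasDerivAt_G' hg hρ) (hasDerivAt_G'' hg hρ) ?_
  intro ξ hξ
  refine (abs_G3_le hg ξ).trans ?_
  have hg4 : g ξ ^ 4 = ((ξ ^ 2 + ρ ^ 2)⁻¹) ^ 2 := by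
    rw [show (4:ℕ) = 2 * 2 from rfl, pow_mul, G_sq hg]
  rw [hg4, inv_pow, ← div_eq_mul_inv]
  have hpos : 0 < (max x 0) ^ 2 + ρ ^ 2 := by positivity
  -- (max x 0)^2 ≤ ξ^2 for ξ ∈ [x, x+3], x ≥ -3
  have H : (max x 0) ^ 2 ≤ ξ ^ 2 := by
    rcases le_or_gt x 0 with h | h
    · rw [max_eq_right h, zero_pow two_ne_zero]; positivity
    · rw [max_eq_left h.le]
      have : x ≤ ξ := hξ.1
      nlinarith
  have h0 : (0 : ℝ) ≤ (max x 0) ^ 2 + ρ ^ 2 := by positivity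
  refine div_le_div_of_nonneg_left (by norm_num) (by positivity) ?_
  exact pow_le_pow_left₀ h0 (add_le_add H le_rfl) 2

/-! ## Summed bounds -/

/-- `Σ_{v<K} 1/(v² + ρ²) ≤ 4/ρ` for `ρ ≥ 1` (`v ≤ ρ`: at most `ρ+1` terms of size `1/ρ²`; `v > ρ`:
the tail `Σ 1/v² ≤ 2/(⌊ρ⌋+1)`). [folklore] -/
theorem sum_inv_sq_add_sq_le (hρ : 1 ≤ ρ) (K : ℕ) :
    ∑ v ∈ range K, ((v : ℝ) ^ 2 + ρ ^ 2)⁻¹ ≤ 4 / ρ := by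
  have hρ0 : 0 < ρ := by linarith
  set n : ℕ := ⌊ρ⌋₊ with hn
  have hn1 : (n : ℝ) ≤ ρ := Nat.floor_le hρ0.le
  have hn2 : ρ < n + 1 := Nat.lt_floor_add_one ρ
  -- split range K into v ≤ n and v > n
  have hsplit : ∑ v ∈ range K, ((v : ℝ) ^ 2 + ρ ^ 2)⁻¹
      = ∑ v ∈ (range K).filter (· ≤ n), ((v : ℝ) ^ 2 + ρ ^ 2)⁻¹
        + ∑ v ∈ (range K).filter (fun v => ¬ v ≤ n), ((v : ℝ) ^ 2 + ρ ^ 2)⁻¹ :=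
    (sum_filter_add_sum_filter_not _ _ _).symm
  rw [hsplit]
  have h1 : ∑ v ∈ (range K).filter (· ≤ n), ((v : ℝ) ^ 2 + ρ ^ 2)⁻¹ ≤ 2 / ρ := by
    calc ∑ v ∈ (range K).filter (· ≤ n), ((v : ℝ) ^ 2 + ρ ^ 2)⁻¹
        ≤ ∑ v ∈ (range K).filter (· ≤ n), (ρ ^ 2)⁻¹ := by
          refine sum_le_sum fun v _ => ?_
          apply inv_anti₀ (by positivity)
          nlinarith
      _ = ((range K).filter (· ≤ n)).card * (ρ ^ 2)⁻¹ := by rw [sum_const, nsmul_eq_mul]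
      _ ≤ (n + 1 : ℝ) * (ρ ^ 2)⁻¹ := by
          gcongr
          have : (range K).filter (· ≤ n) ⊆ range (n + 1) := by
            intro v hv
            simp only [mem_filter, mem_range] at hv ⊢
            omega
          exact_mod_cast (card_le_card this).trans (by simp)
      _ ≤ (ρ + 1) * (ρ ^ 2)⁻¹ := by gcongr
      _ ≤ 2 / ρ := by
          rw [← div_eq_mul_inv, div_le_div_iff₀ (by positivity) hρ0]
          nlinarith
  have h2 : ∑ v ∈ (range K).filter (fun v => ¬ v ≤ n), ((v : ℝ) ^ 2 + ρ ^ 2)⁻¹ ≤ 2 / ρ := by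
    calc ∑ v ∈ (range K).filter (fun v => ¬ v ≤ n), ((v : ℝ) ^ 2 + ρ ^ 2)⁻¹
        ≤ ∑ v ∈ (range K).filter (fun v => ¬ v ≤ n), ((v : ℝ) ^ 2)⁻¹ := by
          refine sum_le_sum fun v hv => ?_
          simp only [mem_filter, mem_range, not_le] at hv
          have : (0 : ℝ) < v := by exact_mod_cast (Nat.zero_lt_of_lt hv.2)
          apply inv_anti₀ (by positivity)
          nlinarith
      _ ≤ ∑ v ∈ Ioo n (max K (n + 1)), ((v : ℝ) ^ 2)⁻¹ := by
          apply sum_le_sum_of_subset_of_nonneg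
          · intro v hv
            simp only [mem_filter, mem_range, not_le] at hv
            simp only [mem_Ioo]
            omega
          · intro v _ _; positivity
      _ ≤ 2 / (n + 1 : ℝ) := sum_Ioo_inv_sq_le n _
      _ ≤ 2 / ρ := by
          apply div_le_div_of_nonneg_left (by norm_num) hρ0 hn2.le
  calc _ ≤ 2 / ρ + 2 / ρ := add_le_add h1 h2
    _ = 4 / ρ := by ring

/-- Summed third-difference bound: for `ρ ≥ 1`, `σ ≤ 2` and every `K`,
`Σ_{u<K} |Δ³ g_ρ(u - σ)| ≤ 144/ρ³`. [folklore] -/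
theorem sum_abs_third_diff_G_le (hg : ∀ y, g y = (Real.sqrt (y ^ 2 + ρ ^ 2))⁻¹) (hρ : 1 ≤ ρ)
    {σ : ℕ} (hσ : σ ≤ 2) (K : ℕ) :
    ∑ u ∈ range K, |g ((u : ℝ) - σ + 3) - 3 * g ((u : ℝ) - σ + 2) + 3 * g ((u : ℝ) - σ + 1)
        - g ((u : ℝ) - σ)| ≤ 144 / ρ ^ 3 := by
  have hρ0 : 0 < ρ := by linarith
  have hρne : ρ ≠ 0 := hρ0.ne'
  -- pointwise bound
  have hpt : ∀ u ∈ range K, |g ((u : ℝ) - σ + 3) - 3 * g ((u : ℝ) - σ + 2)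
      + 3 * g ((u : ℝ) - σ + 1) - g ((u : ℝ) - σ)|
        ≤ 24 / ((max ((u : ℝ) - σ) 0) ^ 2 + ρ ^ 2) ^ 2 := by
    intro u _
    exact abs_third_diff_G_le hg hρne _
  refine (sum_le_sum hpt).trans ?_
  -- split off the (at most two) terms with u < σ
  rw [← sum_filter_add_sum_filter_not (range K) (fun u => u < σ)]
  have hA : ∑ u ∈ (range K).filter (fun u => u < σ),
      24 / ((max ((u : ℝ) - σ) 0) ^ 2 + ρ ^ 2) ^ 2 ≤ 2 * (24 / ρ ^ 4) := by
    calc ∑ u ∈ (range K).filter (fun u => u < σ), 24 / ((max ((u : ℝ) - σ) 0) ^ 2 + ρ ^ 2) ^ 2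
        ≤ ∑ u ∈ (range K).filter (fun u => u < σ), 24 / ρ ^ 4 := by
          refine sum_le_sum fun u _ => ?_
          apply div_le_div_of_nonneg_left (by norm_num) (by positivity)
          calc ρ ^ 4 = (0 + ρ ^ 2) ^ 2 := by ring
            _ ≤ ((max ((u : ℝ) - σ) 0) ^ 2 + ρ ^ 2) ^ 2 := by gcongr; positivity
      _ = ((range K).filter (fun u => u < σ)).card * (24 / ρ ^ 4) := by
          rw [sum_const, nsmul_eq_mul]
      _ ≤ 2 * (24 / ρ ^ 4) := by
          gcongr
          have : (range K).filter (fun u => u < σ) ⊆ range 2 := by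
            intro u hu
            simp only [mem_filter, mem_range] at hu ⊢
            omega
          exact_mod_cast (card_le_card this).trans (by simp)
  have hB : ∑ u ∈ (range K).filter (fun u => ¬ u < σ),
      24 / ((max ((u : ℝ) - σ) 0) ^ 2 + ρ ^ 2) ^ 2 ≤ 24 * (ρ ^ 2)⁻¹ * (4 / ρ) := by
    set F : ℕ → ℝ := fun v => 24 / (((v : ℝ)) ^ 2 + ρ ^ 2) ^ 2 with hF
    have hpt' : ∀ u ∈ (range K).filter (fun u => ¬ u < σ),
        24 / ((max ((u : ℝ) - σ) 0) ^ 2 + ρ ^ 2) ^ 2 = F (u - σ) := by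
      intro u hu
      simp only [mem_filter, mem_range, not_lt] at hu
      simp only [hF]
      rw [Nat.cast_sub hu.2, max_eq_left (sub_nonneg.mpr (by exact_mod_cast hu.2))]
    have hinj : Set.InjOn (fun u => u - σ) ((range K).filter (fun u => ¬ u < σ) : Set ℕ) := by
      intro u hu u' hu' h
      simp only [coe_filter, mem_range, not_lt, Set.mem_setOf_eq] at hu hu'
      simp only at h
      omega
    calc ∑ u ∈ (range K).filter (fun u => ¬ u < σ), 24 / ((max ((u : ℝ) - σ) 0) ^ 2 + ρ ^ 2) ^ 2
        = ∑ u ∈ (range K).filter (fun u => ¬ u < σ), F (u - σ) := sum_congr rfl hpt'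
      _ = ∑ v ∈ ((range K).filter (fun u => ¬ u < σ)).image (fun u => u - σ), F v :=
          (sum_image hinj).symm
      _ ≤ ∑ v ∈ range K, F v := by
          apply sum_le_sum_of_subset_of_nonneg
          · intro v hv
            simp only [mem_image, mem_filter, mem_range, not_lt] at hv
            simp only [mem_range]
            obtain ⟨u, ⟨hu, _⟩, rfl⟩ := hv
            omega
          · intro v _ _; simp only [hF]; positivity
      _ ≤ ∑ v ∈ range K, 24 * (ρ ^ 2)⁻¹ * ((v : ℝ) ^ 2 + ρ ^ 2)⁻¹ := by
          refine sum_le_sum fun v _ => ?_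
          simp only [hF]
          have hpos : 0 < (v : ℝ) ^ 2 + ρ ^ 2 := by positivity
          rw [div_eq_mul_inv, mul_assoc, ← mul_inv, pow_two ((v:ℝ) ^ 2 + ρ ^ 2)]
          gcongr
          nlinarith
      _ = 24 * (ρ ^ 2)⁻¹ * ∑ v ∈ range K, ((v : ℝ) ^ 2 + ρ ^ 2)⁻¹ := by rw [mul_sum]
      _ ≤ 24 * (ρ ^ 2)⁻¹ * (4 / ρ) := by
          gcongr
          exact sum_inv_sq_add_sq_le hρ K
  calc _ ≤ 2 * (24 / ρ ^ 4) + 24 * (ρ ^ 2)⁻¹ * (4 / ρ) := add_le_add hA hB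
    _ = 48 / ρ ^ 4 + 96 / ρ ^ 3 := by field_simp; ring
    _ ≤ 48 / ρ ^ 3 + 96 / ρ ^ 3 := by
        gcongr 48 / ?_ + _
        calc ρ ^ 3 = ρ ^ 3 * 1 := by ring
          _ ≤ ρ ^ 3 * ρ := by gcongr
          _ = ρ ^ 4 := by ring
    _ = 144 / ρ ^ 3 := by ring

end profile

end Summit.AtomisticToContinuum.BoseEinsteinCondensation.Cruxes.LevyNegativeMoment.Birth.Riesz
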